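import Summits.QuantumFields.BalabanUV.Beta.VhPieceReflection

/-!
# (Sr-conj) AT `j = 0` FOR THE NATIVE SPINE, MODULO THE WILSON LAW: if the first-order Wilson stencil reflects with the field–field block of
# the diagonal contact (an3's claim «WILSON-REFLECTION-WITH-CONTACT», CLAIMS.log l.4160) and the coefficients satisfy ONE normalisation
# identity, then the whole `j = 0` stencil `S0NAt ρ_c cE cVH cΛ` satisfies EXACTLY the socket hSrC of the coarse wiring with the single
# contact `C 0 α κ′ u := (cVH/Lc^{d+1}) • diagK (ctGen d α Lc κ′ u)` (β sub-cell, row BETA-an2, gen 14; NOTE X-an2-45 §3 / (R45-4))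

HONEST FRAMING (cell charter, verbatim): «discharging BetaPertH makes Balaban's UV stability UNCONDITIONAL — a real
constructive-QFT result; it is NOT the continuum limit and NOT the Clay problem.»  DERIVED cell leaf (pub-balaban β sub-cell, lane
an2 gen 14); no statement of Bałaban's papers is typed here, no `[cite:]` tag, no `Prop` fact; it instantiates no binder of the
β-function wall by itself.  The Wilson law enters as an explicit HYPOTHESIS (`hWff`, its field–field block, with a free constant `c`); nothing is
asserted about an3's table.  NOT `BetaPertH`; NOT continuum; NOT Clay.

## What is here ([folklore] bookkeeping over `SpineRootedS0N`, `DiagonalContact`, `VhPieceReflection`, `LambdaPieceReflection`)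

* `S0NAt_apply_split3` — `S0NAt ρ cE cVH cΛ κ′ u = cE • wilsonA κ′ u + S0NAt ρ 0 cVH cΛ κ′ u` entrywise.
* **`S0NAt_bref_of_wilsonLaw`**: HYPOTHESES (i) `hWff`: for every axis `α`, jet bond `(κ′, u)` and FIELD–FIELD entry `x z (inl a) (inl b)`,
  `wilsonA d κ′ (bref α κ′ u) x z (inl a) (inl b) = reflSign α κ′ · s(inl a) · s(inl b) · (wilsonA d κ′ u (r x) (r z) (inl a) (inl b) + c · D (r x) (r z) (inl a) (inl b))`
  with `D := conjV (bhKAt d ρ_c Lc) (diagK (ctGen d α Lc κ′ u))` and `(r, s) := Φ Lc α` — i.e. the `(inl, inl)` block of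
  `wilsonA d κ′ (bref α κ′ u) = reflSign α κ′ • refK (Φ Lc α) (wilsonA d κ′ u + c • D)`; the other three blocks of `wilsonA` vanish by `rfl` and
  need no hypothesis; (ii) the NORMALISATION `hc : cE * c = cVH / Lc^{d+1}`.  CONCLUSION: for every axis `α`, jet bond `(κ′, u)`,
  `S0NAt d Lc ρ_c cE cVH cΛ κ′ (bref α κ′ u) = reflSign α κ′ • refK (Φ Lc α) (S0NAt d Lc ρ_c cE cVH cΛ κ′ u + conjV (bhKAt d ρ_c Lc) ((cVH / Lc^{d+1}) • diagK (ctGen d α Lc κ′ u)))`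
  — the hypothesis hSrC of `SpineRooted.axisReflectionCovariant_flipK_TbalOf_JsBalBmNAtOf_ctrC` at `j = 0`, with `𝕄 0 := bhKAt d ρ_c Lc`
  (`relInv_coDressKBmAt_KInvStep_zero_bhKAt`) and an `axEc`-commuting contact (`comp_axEc_diagK_comm`).
READING (asserted nowhere): with an1-g22's orientation `cVH = −Lc^{d+1}·cE` the normalisation reads `c = −1` in the units of
`conjV_bhKAt_ctGen_inl_inl`; an3-g28 will fix `c` in the kernel — agreement is a CONSISTENCY TEST of the typed normalisations, not an
assumption of this file.  All declarations `[folklore]`; axioms standard.  Provenance: b2b-balaban β sub-cell, unit beta-an2 gen 14, 2026-08-20.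
-/

open Finset
open scoped BigOperators
open Literature.MathematicalPhysics.QuantumFieldTheory
open Literature.MathematicalPhysics.QuantumFieldTheory.Balaban1983to89
open Literature.MathematicalPhysics.QuantumFieldTheory.Balaban1983to89.Beta
open ExpKernelCalculus (MKer)
open AveragingContoursRooted (ctr)
open StepJetData (wilsonA)
open PolarizationSign (reflSign)
open KernelReflection (refK refK_apply)
open ResolventReflection (bref Φ Φ_r_inl Φ_r_inr Φ_s_inl Φ_s_inr)
open OneStepResolventKernel (Fib)
open Summit.QuantumFields.BalabanUV.Beta.ChartConjugation (conjV)
open Summit.QuantumFields.BalabanUV.Beta.BorderedHessian (bhKAt diagK ctGen conjV_bhKAt_ctGen_inl_inr conjV_bhKAt_ctGen_inr_inl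
  conjV_bhKAt_ctGen_inr_inr conjV_bhKAt_ctGen_inl_inl_of_ne)

noncomputable section

namespace Summit.QuantumFields.BalabanUV.Beta.SpineRooted

variable {d : ℕ} {Lc : ℕ} [NeZero Lc]

/-- [folklore] The spine splits off its Wilson summand entrywise: `S0NAt ρ cE cVH cΛ κ′ u = cE • wilsonA κ′ u + S0NAt ρ 0 cVH cΛ κ′ u`. -/
theorem S0NAt_apply_split3 (ρ : Fin (d + 1) → ℤ) (cE cVH cΛ : ℝ) (κ' : Fin (d + 1)) (u x z : Fin (d + 1) → ℤ) (a b : Fib d) :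
    S0NAt d Lc ρ cE cVH cΛ κ' u x z a b = cE * wilsonA d κ' u x z a b + S0NAt d Lc ρ 0 cVH cΛ κ' u x z a b := by
  simp only [S0NAt, Pi.add_apply, Pi.smul_apply, smul_eq_mul, zero_mul, zero_add]
  ring

/-- [folklore] **(Sr-conj) AT `j = 0` FOR THE NATIVE SPINE, MODULO THE WILSON LAW WITH CONTACT.**  See the module docstring for the
shape of the hypotheses; the field–field block of the Wilson law carries the contact `c • (conjV (bhKAt) (diagK ctGen))_{ff}`, the other
blocks of `wilsonA` reflect trivially (they vanish), and `cE * c = cVH / Lc^{d+1}`. -/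
theorem S0NAt_bref_of_wilsonLaw (hLc : Odd Lc) (cE cVH cΛ c : ℝ) (hc : cE * c = cVH / (Lc : ℝ) ^ (d + 1))
    (hWff : ∀ (α κ' : Fin (d + 1)) (u x z : Fin (d + 1) → ℤ) (a b : Fin (d + 1)),
      wilsonA d κ' (bref α κ' u) x z (Sum.inl a) (Sum.inl b) =
        reflSign α κ' * ((Φ Lc α).s (Sum.inl a) * (Φ Lc α).s (Sum.inl b) *
          (wilsonA d κ' u ((Φ Lc α).r (Sum.inl a) x) ((Φ Lc α).r (Sum.inl b) z) (Sum.inl a) (Sum.inl b) +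
            c * conjV (bhKAt d (ctr (d + 1) Lc) Lc) (diagK (ctGen d α Lc κ' u))
              ((Φ Lc α).r (Sum.inl a) x) ((Φ Lc α).r (Sum.inl b) z) (Sum.inl a) (Sum.inl b))))
    (α κ' : Fin (d + 1)) (u : Fin (d + 1) → ℤ) :
    S0NAt d Lc (ctr (d + 1) Lc) cE cVH cΛ κ' (bref α κ' u) =
      reflSign α κ' • refK (Φ Lc α) (S0NAt d Lc (ctr (d + 1) Lc) cE cVH cΛ κ' u +
        conjV (bhKAt d (ctr (d + 1) Lc) Lc) ((cVH / (Lc : ℝ) ^ (d + 1)) • diagK (ctGen d α Lc κ' u))) := by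
  -- the vh+Λ slice, blockwise (every κ′): the four block lemmas of `VhPieceReflection`/`LambdaPieceReflection`
  have hvl : ∀ x z a b, S0NAt d Lc (ctr (d + 1) Lc) 0 cVH cΛ κ' (bref α κ' u) x z a b =
      (reflSign α κ' • refK (Φ Lc α) (S0NAt d Lc (ctr (d + 1) Lc) 0 cVH cΛ κ' u +
        conjV (bhKAt d (ctr (d + 1) Lc) Lc) ((cVH / (Lc : ℝ) ^ (d + 1)) • diagK (ctGen d α Lc κ' u)))) x z a b -
      (reflSign α κ' * ((Φ Lc α).s a * (Φ Lc α).s b *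
        ((cVH / (Lc : ℝ) ^ (d + 1)) * (if (∃ a' b', a = Sum.inl a' ∧ b = Sum.inl b') then
          conjV (bhKAt d (ctr (d + 1) Lc) Lc) (diagK (ctGen d α Lc κ' u)) ((Φ Lc α).r a x) ((Φ Lc α).r b z) a b else 0)))) := by
    intro x z a b
    -- split the vh+Λ slice into vh and Λ
    have hsplit : ∀ w x' z' a' b', S0NAt d Lc (ctr (d + 1) Lc) 0 cVH cΛ κ' w x' z' a' b' =
        S0NAt d Lc (ctr (d + 1) Lc) 0 cVH 0 κ' w x' z' a' b' + S0NAt d Lc (ctr (d + 1) Lc) 0 0 cΛ κ' w x' z' a' b' := by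
      intro w x' z' a' b'
      have e := congrFun (congrFun (S0NAt_split d Lc (ctr (d + 1) Lc) 0 cVH cΛ) κ') w
      have e' := congrFun (congrFun (congrFun (congrFun e x') z') a') b'
      simpa using e'
    have hΛ := congrFun (congrFun (congrFun (congrFun (S0NAt_lam_reflect (d := d) hLc cΛ α κ' u) x) z) a) b
    simp only [Pi.smul_apply, smul_eq_mul, refK_apply] at hΛ
    simp only [Pi.smul_apply, Pi.add_apply, smul_eq_mul, refK_apply, conjV_smul_right]
    simp only [hsplit]
    rcases a with β | μ <;> rcases b with β' | μ'
    · have hv0 : S0NAt d Lc (ctr (d + 1) Lc) 0 cVH 0 κ' (bref α κ' u) x z (Sum.inl β) (Sum.inl β') = 0 := by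
        rw [S0NAt_vh_ctr_apply]; exact mul_eq_zero.2 (Or.inr rfl)
      have hv1 : S0NAt d Lc (ctr (d + 1) Lc) 0 cVH 0 κ' u ((Φ Lc α).r (Sum.inl β) x) ((Φ Lc α).r (Sum.inl β') z)
          (Sum.inl β) (Sum.inl β') = 0 := by
        rw [S0NAt_vh_ctr_apply]; exact mul_eq_zero.2 (Or.inr rfl)
      have : (∃ a' b', (Sum.inl β : Fib d) = Sum.inl a' ∧ (Sum.inl β' : Fib d) = Sum.inl b') := ⟨β, β', rfl, rfl⟩
      rw [if_pos this, hv0, hv1, hΛ]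
      ring
    · have hv := S0NAt_vh_bref_inl_inr hLc cVH α κ' u x z β μ'
      simp only [Pi.smul_apply, Pi.add_apply, smul_eq_mul, refK_apply, conjV_smul_right] at hv
      have : ¬ (∃ a' b', (Sum.inl β : Fib d) = Sum.inl a' ∧ (Sum.inr μ' : Fib d) = Sum.inl b') := by
        rintro ⟨a', b', -, h⟩; cases h
      rw [if_neg this, hv, hΛ]
      ring
    · have hv := S0NAt_vh_bref_inr_inl hLc cVH α κ' u x z μ β'
      simp only [Pi.smul_apply, Pi.add_apply, smul_eq_mul, refK_apply, conjV_smul_right] at hv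
      have : ¬ (∃ a' b', (Sum.inr μ : Fib d) = Sum.inl a' ∧ (Sum.inl β' : Fib d) = Sum.inl b') := by
        rintro ⟨a', b', h, -⟩; cases h
      rw [if_neg this, hv, hΛ]
      ring
    · have hv := S0NAt_vh_bref_inr_inr hLc cVH α κ' u x z μ μ'
      simp only [Pi.smul_apply, Pi.add_apply, smul_eq_mul, refK_apply, conjV_smul_right] at hv
      have : ¬ (∃ a' b', (Sum.inr μ : Fib d) = Sum.inl a' ∧ (Sum.inr μ' : Fib d) = Sum.inl b') := by
        rintro ⟨a', b', h, -⟩; cases h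
      rw [if_neg this, hv, hΛ]
      ring
  funext x z a b
  rw [S0NAt_apply_split3 _ cE cVH cΛ κ' (bref α κ' u) x z a b, hvl x z a b]
  simp only [Pi.smul_apply, Pi.add_apply, smul_eq_mul, refK_apply, conjV_smul_right]
  rw [S0NAt_apply_split3 _ cE cVH cΛ κ' u]
  rcases a with β | μ <;> rcases b with β' | μ'
  · rw [hWff α κ' u x z β β']
    have : (∃ a' b', (Sum.inl β : Fib d) = Sum.inl a' ∧ (Sum.inl β' : Fib d) = Sum.inl b') := ⟨β, β', rfl, rfl⟩
    rw [if_pos this]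
    have hc' : cVH / (Lc : ℝ) ^ (d + 1) = cE * c := hc.symm
    rw [hc']
    ring
  · have h1 : wilsonA d κ' (bref α κ' u) x z (Sum.inl β) (Sum.inr μ') = 0 := rfl
    have h2 : wilsonA d κ' u ((Φ Lc α).r (Sum.inl β) x) ((Φ Lc α).r (Sum.inr μ') z) (Sum.inl β) (Sum.inr μ') = 0 := rfl
    have : ¬ (∃ a' b', (Sum.inl β : Fib d) = Sum.inl a' ∧ (Sum.inr μ' : Fib d) = Sum.inl b') := by
      rintro ⟨a', b', -, h⟩; cases h
    rw [h1, h2, if_neg this]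
    ring
  · have h1 : wilsonA d κ' (bref α κ' u) x z (Sum.inr μ) (Sum.inl β') = 0 := rfl
    have h2 : wilsonA d κ' u ((Φ Lc α).r (Sum.inr μ) x) ((Φ Lc α).r (Sum.inl β') z) (Sum.inr μ) (Sum.inl β') = 0 := rfl
    have : ¬ (∃ a' b', (Sum.inr μ : Fib d) = Sum.inl a' ∧ (Sum.inl β' : Fib d) = Sum.inl b') := by
      rintro ⟨a', b', h, -⟩; cases h
    rw [h1, h2, if_neg this]
    ring
  · have h1 : wilsonA d κ' (bref α κ' u) x z (Sum.inr μ) (Sum.inr μ') = 0 := rfl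
    have h2 : wilsonA d κ' u ((Φ Lc α).r (Sum.inr μ) x) ((Φ Lc α).r (Sum.inr μ') z) (Sum.inr μ) (Sum.inr μ') = 0 := rfl
    have : ¬ (∃ a' b', (Sum.inr μ : Fib d) = Sum.inl a' ∧ (Sum.inr μ' : Fib d) = Sum.inl b') := by
      rintro ⟨a', b', h, -⟩; cases h
    rw [h1, h2, if_neg this]
    ring

end Summit.QuantumFields.BalabanUV.Beta.SpineRooted

end
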